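import Mathlib
import HarnessLib
import Summits.Ventures.LatticeQCDFlow.Scaling.AcceptanceEssEightNinths
import Summits.Ventures.LatticeQCDFlow.Scoring.AcceptanceMonitorBatch

/-!
# LatticeQCDFlow / Scoring — the `8/9` law read on the batch: on every training checkpoint the two
# printed monitors satisfy `acc_est ≥ ((8/9)·n·ess − 1)/(n − 1)` identically

HONEST FRAMING: exact (Metropolis-corrected) sampling algorithms for lattice gauge theory;
figures of merit are autocorrelation/cost numbers at stated couplings and volumes; no
continuum-physics claim.

Venture `LatticeQCDFlow` (cell pub-lqcd), sub-topic `Scoring`; FANOUT row 3 (`s0-u1-a`, S0-B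
implementation A, GEN-8).  NEW WORK of the cell (the population law of row 3's
`Scaling/AcceptanceEssEightNinths`, imported, instantiated at the empirical law of a batch), not a
published result; NO definition is introduced.  It upgrades the constant `1/2` of row 3's
`Scoring/AcceptanceMonitorBatch` (GEN-6, imported: `half_kishFrac_le_plugIn`,
`half_kishESS_sub_one_div_le_accMonitor`) to the sharp `8/9`.

## Content (a batch `W : ι → ℝ` of `n` POSITIVE un-normalised weights; the flows_jax trainer's
## monitors `ess = kish_ess_frac = (ΣW)²/(nΣW²)` and
## `acc_est = imh_acceptance_estimate = Σ_{i≠j} min(W_i, W_j)/((n − 1)ΣW)`)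

* **`eight_ninths_kishFrac_le_plugIn`** — `(8/9)·(ΣW)²/(nΣW²) ≤ Σ_iΣ_j min(W_i, W_j)/(nΣW)`
  (the plug-in acceptance is at least `8/9` of the Kish fraction, on EVERY positive batch);
* **`eight_ninths_kishESS_sub_one_div_le_accMonitor`** — for `n ≥ 2`:
  `((8/9)·kishESS − 1)/(n − 1) ≤ acc_est` with `kishESS = (ΣW)²/ΣW²` the Kish count, i.e.
  `acc_est ≥ ((8/9)·n·ess − 1)/(n − 1)`: a checkpoint printing `ess = 0.9`, `n = 8192` must print
  `acc_est ≥ 0.7999`; a violating pair is an implementation defect, not a fluctuation.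

NOT CLAIMED: any monitor value of ours; the converse direction (no upper bound on `acc_est` from
`ess` exists); nothing re-scored.
-/

namespace Summit.Ventures.LatticeQCDFlow.Scoring

open Finset
open Summit.Ventures.LatticeQCDFlow.Exactness
open Summit.Ventures.LatticeQCDFlow.Theory2

variable {ι : Type*} [Fintype ι] [DecidableEq ι]

omit [DecidableEq ι] in
/-- **Plug-in acceptance ≥ `8/9` of the Kish fraction** on every positive batch:
`(8/9)·(ΣW)²/(nΣW²) ≤ Σ_iΣ_j min(W_i, W_j)/(nΣW)` (row 3's `eight_ninths_essFrac_le_accRate` at the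
empirical law `W/ΣW` against the uniform law). [folklore] -/
theorem eight_ninths_kishFrac_le_plugIn [Nonempty ι] {W : ι → ℝ} (hW : ∀ i, 0 < W i) :
    8 / 9 * ((∑ i, W i) ^ 2 / (Fintype.card ι * ∑ i, W i ^ 2))
      ≤ (∑ i, ∑ j, min (W i) (W j)) / (Fintype.card ι * ∑ i, W i) := by
  have hS : 0 < ∑ j, W j := sum_pos (fun i _ => hW i) univ_nonempty
  have hn : 0 < (Fintype.card ι : ℝ) := Nat.cast_pos.2 Fintype.card_pos
  have h := eight_ninths_essFrac_le_accRate (p := fun i => W i / ∑ j, W j)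
    (q := fun _ => ((Fintype.card ι : ℝ))⁻¹) (fun i => (div_pos (hW i) hS).le)
    (fun _ => inv_pos.2 hn) (sum_selfNorm_eq_one hW) sum_uniform_eq_one
  rwa [accRate_selfNorm_uniform hW, essFrac_selfNorm_uniform hW] at h

/-- **The printed monitors obey `acc_est ≥ ((8/9)·kishESS − 1)/(n − 1)`** on every positive batch of
`n ≥ 2` proposals (`kishESS = (ΣW)²/ΣW² = n·ess`). [folklore] -/
theorem eight_ninths_kishESS_sub_one_div_le_accMonitor {W : ι → ℝ} (hW : ∀ i, 0 < W i)
    (hn : 2 ≤ Fintype.card ι) :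
    (8 / 9 * kishESS univ W - 1) / (Fintype.card ι - 1)
      ≤ (∑ i, ∑ j ∈ univ.erase i, min (W i) (W j)) / ((Fintype.card ι - 1) * ∑ i, W i) := by
  haveI : Nonempty ι := Fintype.card_pos_iff.1 (by omega)
  have hnpos : 0 < (Fintype.card ι : ℝ) := Nat.cast_pos.2 Fintype.card_pos
  have hn1 : 0 < (Fintype.card ι : ℝ) - 1 := by
    have : (2 : ℝ) ≤ Fintype.card ι := by exact_mod_cast hn
    linarith
  rw [accMonitor_eq_plugIn hW hn]
  refine div_le_div_of_nonneg_right ?_ hn1.le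
  have h := eight_ninths_kishFrac_le_plugIn hW
  rw [← kishESS_univ_div_card] at h
  -- `(8/9)·(K/n) ≤ V` gives `(8/9)·K − 1 ≤ n·V − 1`
  have h2 := mul_le_mul_of_nonneg_left h hnpos.le
  have e : (Fintype.card ι : ℝ) * (8 / 9 * (kishESS univ W / Fintype.card ι))
      = 8 / 9 * kishESS univ W := by
    field_simp
  rw [e] at h2
  linarith

end Summit.Ventures.LatticeQCDFlow.Scoring
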